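import Summits.CriticalPhenomena.PercolationContinuityZ3.Theorems.SahiMasterFamilyPointwiseFaceVanishing
import Summits.CriticalPhenomena.PercolationContinuityZ3.Theorems.PercNearOneGluingNoHeavyLowerTailSahiCombPrivate
import Summits.CriticalPhenomena.PercolationContinuityZ3.Theorems.SahiMasterFamilyPrivateGluing

/-!
# The pointwise zero locus under PRIVATE extension: one private coordinate at a time

Unit `prim-master-conj` (crux anchor stmt-CriticalPhenomena-4575, helper work), gen 13; companion of `SahiMasterFamilyPointwise*.lean`.
If the coordinate `e` acts on the member `U_i` only, then (seat P3, `SahiCombPrivate.sahiE_ind_private_eq`)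
`E_k(μ_p; 1_U) = (1 − p_e)·E_k(μ_p; 1_{U[i ↦ U_i^{e←0}]}) + p_e·E_k(μ_p; 1_{U[i ↦ U_i^{e←1}]})` — AFFINE in `p_e` — and `Z_k` is closed under this
private gluing (Lemma P at every order, `suppZeroFlag_of_secAt`, this unit gen 7).  Hence the LAW-LEVEL (not comb-level) inheritance:

* `sahiE_ind_eq_zero_iff_of_private_sections` — if at the interior point `p` both section families have `E_k ≥ 0` and satisfy the pointwise
  statement "`E_k = 0 ⟹ Z_k`", then so does `U`: `E_k(μ_p; 1_U) = 0 ↔ U ∈ Z_k` (and `E_k(μ_p; 1_U) ≥ 0`, `sahiE_ind_nonneg_of_private_sections`).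
  So the class {pointwise (EQ-k) ∧ (M-k)} is closed under attaching private structure to a member, one coordinate at a time — with no comb
  certificate needed (compare P3's comb-level `combPos_sahiE_ind_of_private`).
* `sahiE_three_ind_eq_zero_iff_of_private_faceVanishing` — example: a triple whose two `e`-sections at a coordinate `e` private to `U_i` are
  FACE-VANISHING (gen 13: pointwise (EQ-3) and `C₃` there) satisfies pointwise (EQ-3) — a class outside the face-vanishing one (a face-vanishing
  triple with a private coordinate is already in `Z₃`).
Nothing is asserted in general; axioms standard. [this work]
-/

noncomputable section

open scoped Classical

namespace Summit.CriticalPhenomena.PercolationContinuityZ3.Theorems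

open Finset Function
open Literature.Combinatorics.Sahi2008
open Literature.Probability.LatticeModels.Kahn2022 (Affects)
open Literature.Probability.Percolation (DeterminedBy)
open Literature.Probability.Percolation.DecisionTree (ind)

namespace Pointwise

variable {ι : Type} [Fintype ι]

omit [Fintype ι] in
/-- Updating one member of an increasing family by a section keeps it increasing. [this work] -/
theorem isUpperSet_update_secAt {k : ℕ} {U : Fin k → Set (Set ι)} (hU : ∀ j, IsUpperSet (U j)) (i : Fin k) (e : ι) (b : Bool) :
    ∀ j, IsUpperSet (update U i (secAt e b (U i)) j) := by
  intro j
  by_cases h : j = i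
  · subst h; rw [update_self]; exact isUpperSet_secAt e b (hU j)
  · rw [update_of_ne h]; exact hU j

/-- **Positivity at `p` is inherited under private extension** (the affine identity in `p_e`). [this work] -/
theorem sahiE_ind_nonneg_of_private_sections (p : ι → unitInterval) {n : ℕ} (U : Fin (n + 1) → Set (Set ι)) (hU : ∀ j, IsUpperSet (U j))
    (i : Fin (n + 1)) (e : ι) (hpriv : ∀ j, j ≠ i → ¬ Affects (U j) e)
    (h0 : 0 ≤ sahiE (bernoulliWeight p) (n + 1) (fun j => ind (update U i (secAt e false (U i)) j)))
    (h1 : 0 ≤ sahiE (bernoulliWeight p) (n + 1) (fun j => ind (update U i (secAt e true (U i)) j))) :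
    0 ≤ sahiE (bernoulliWeight p) (n + 1) (fun j => ind (U j)) := by
  rw [SahiCombPrivate.sahiE_ind_private_eq p U hU i e hpriv]
  exact add_nonneg (mul_nonneg (sub_nonneg.2 (p e).2.2) h0) (mul_nonneg (p e).2.1 h1)

/-- **The pointwise zero locus is inherited under private extension**: for `p` in the open cube and `e` private to the member `U_i`, if both
`e`-section families have `E ≥ 0` at `p` and satisfy "`E = 0` at `p` ⟹ zero flag", then `E_{n+2}(μ_p; 1_U) = 0 ↔ U ∈ Z_{n+2}`. [this work] -/
theorem sahiE_ind_eq_zero_iff_of_private_sections (p : ι → unitInterval) (hp : ∀ f, (p f : ℝ) ∈ Set.Ioo (0 : ℝ) 1) {n : ℕ}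
    (U : Fin (n + 2) → Set (Set ι)) (hU : ∀ j, IsUpperSet (U j)) (i : Fin (n + 2)) (e : ι) (hpriv : ∀ j, j ≠ i → ¬ Affects (U j) e)
    (h0 : 0 ≤ sahiE (bernoulliWeight p) (n + 2) (fun j => ind (update U i (secAt e false (U i)) j)))
    (h1 : 0 ≤ sahiE (bernoulliWeight p) (n + 2) (fun j => ind (update U i (secAt e true (U i)) j)))
    (hz0 : sahiE (bernoulliWeight p) (n + 2) (fun j => ind (update U i (secAt e false (U i)) j)) = 0 →
      SuppZeroFlag (n + 2) (update U i (secAt e false (U i))))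
    (hz1 : sahiE (bernoulliWeight p) (n + 2) (fun j => ind (update U i (secAt e true (U i)) j)) = 0 →
      SuppZeroFlag (n + 2) (update U i (secAt e true (U i)))) :
    sahiE (bernoulliWeight p) (n + 2) (fun j => ind (U j)) = 0 ↔ SuppZeroFlag (n + 2) U := by
  refine ⟨fun hz => ?_, fun hZ => masterFamilyEqIff_mpr _ ι p U hZ⟩
  rw [SahiCombPrivate.sahiE_ind_private_eq p U hU i e hpriv] at hz
  have hpe0 : (0 : ℝ) < p e := (hp e).1
  have hpe1 : (0 : ℝ) < 1 - p e := sub_pos.2 (hp e).2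
  have ha : (1 - (p e : ℝ)) * sahiE (bernoulliWeight p) (n + 2) (fun j => ind (update U i (secAt e false (U i)) j)) = 0 := by
    nlinarith [mul_nonneg hpe1.le h0, mul_nonneg hpe0.le h1]
  have hb : (p e : ℝ) * sahiE (bernoulliWeight p) (n + 2) (fun j => ind (update U i (secAt e true (U i)) j)) = 0 := by
    nlinarith [mul_nonneg hpe1.le h0, mul_nonneg hpe0.le h1]
  have hz0' := (mul_eq_zero.1 ha).resolve_left hpe1.ne'
  have hz1' := (mul_eq_zero.1 hb).resolve_left hpe0.ne'
  exact suppZeroFlag_of_secAt U hU i e hpriv (hz0 hz0') (hz1 hz1')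

/-- **Example at order three: private extension of face-vanishing triples.**  Let `e` act on `U_i` only and suppose BOTH section triples
`U[i ↦ U_i^{e←b}]` are face-vanishing with respect to `S` (all their minors at coordinates of `S` are zero flags).  Then at every interior `p`,
`E₃(μ_p; 1_U) = 0 ↔ U ∈ Z₃`, and `E₃(μ_p; 1_U) ≥ 0`. [this work] -/
theorem sahiE_three_ind_eq_zero_iff_of_private_faceVanishing (p : ι → unitInterval) (hp : ∀ f, (p f : ℝ) ∈ Set.Ioo (0 : ℝ) 1)
    (U : Fin 3 → Set (Set ι)) (hU : ∀ j, IsUpperSet (U j)) (i : Fin 3) (e : ι) (hpriv : ∀ j, j ≠ i → ¬ Affects (U j) e)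
    (S : Finset ι) (hUS : ∀ (b : Bool) (j : Fin 3), DeterminedBy (update U i (secAt e b (U i)) j) (↑S : Set ι))
    (hfv : ∀ (b : Bool), ∀ f ∈ S, ∀ b' : Bool, SuppZeroFlag 3 (fun j => secAt f b' (update U i (secAt e b (U i)) j))) :
    (sahiE (bernoulliWeight p) 3 (fun j => ind (U j)) = 0 ↔ SuppZeroFlag 3 U) ∧ 0 ≤ sahiE (bernoulliWeight p) 3 (fun j => ind (U j)) := by
  have hup : ∀ b : Bool, ∀ j, IsUpperSet (update U i (secAt e b (U i)) j) := fun b => isUpperSet_update_secAt hU i e b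
  have h0 := sahiE_three_nonneg_of_faceVanishing ι p _ S (hup false) (hUS false) (hfv false)
  have h1 := sahiE_three_nonneg_of_faceVanishing ι p _ S (hup true) (hUS true) (hfv true)
  refine ⟨sahiE_ind_eq_zero_iff_of_private_sections p hp U hU i e hpriv h0 h1
    (fun hz => (sahiE_three_ind_eq_zero_iff_of_faceVanishing ι p hp _ S (hup false) (hUS false) (hfv false)).1 hz)
    (fun hz => (sahiE_three_ind_eq_zero_iff_of_faceVanishing ι p hp _ S (hup true) (hUS true) (hfv true)).1 hz),
    sahiE_ind_nonneg_of_private_sections p U hU i e hpriv h0 h1⟩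

end Pointwise

end Summit.CriticalPhenomena.PercolationContinuityZ3.Theorems
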